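import Literature.NumberTheory.PAdicHodge.BmaxZero
import HarnessLib

/-!
# `B_max⁺(F)`: the `p`-adic completion of `B⁰_max = 𝔸_inf[ξ/p]`, with Frobenius and Galois action

Continuation of `BmaxZero`.  Following Berger (2002, §1.2, after Colmez), the crystalline period ring
is built from `B_max⁺ = {Σ_{n≥0} a_n (ξ/p)^n : a_n → 0}`, i.e. the `p`-adic completion of the ring
`B⁰_max = 𝔸_inf[ξ/p]` (`bmaxZero`).  This file constructs

* `frobBmaxZero`, `galBmaxZero σ` — the Frobenius `φ[1/p]` and the `Γ_F`-action restricted to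
  `B⁰_max` (well defined by `frobAinfLoc_mem_bmaxZero`, `galAinfLoc_mem_bmaxZero`), commuting;
* `BmaxPlus F p` — **`B_max⁺(F)`, the `p`-adic completion of `B⁰_max`** (Mathlib `AdicCompletion`
  at the ideal `(p)`), a commutative ring;
* `frobBmaxPlus` — **the Frobenius `φ` of `B_max⁺`**, and `galBmaxPlus σ` — **the action of `Γ_F`**
  (functoriality of adic completions, tree `adicCompletionMap`), with `galBmaxPlus_one`,
  `galBmaxPlus_mul` (a `MulSemiringAction`), and **`φ ∘ σ = σ ∘ φ`** (`galBmaxPlus_frobBmaxPlus`);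
* `ainfToBmaxPlus : 𝔸_inf(F) → B_max⁺(F)`, `φ`- and `Γ_F`-equivariant
  (`frobBmaxPlus_ainfToBmaxPlus`, `galBmaxPlus_ainfToBmaxPlus`).

Not yet here: `t = log[ε] ∈ B_max⁺`, `B_max = B_max⁺[1/t]`, and the (injective) comparison map
`B_max⁺ → B_dR⁺` (Colmez 1998, §III.2), on which the filtration and `B_max^{Γ_F} = F₀` depend.
Definitions: `frobBmaxZero`, `galBmaxZero`, `BmaxPlus`, `frobBmaxPlus`, `galBmaxPlus`,
`ainfToBmaxPlus`.  No named facts.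

## References
* [BergerLaurent2002] L. Berger, *Représentations p-adiques et équations différentielles*,
  Invent. Math. 148 (2002), §1.2 (p. 8 of arXiv:math/0102179).
* [FontaineAsterisque223III] J.-M. Fontaine, Astérisque 223 (1994), Exp. II §2.3 (`A_cris`, for comparison).
-/

noncomputable section

open WittVector Field ValuativeRel
open Literature.AlgebraicGeometry.Resolution

namespace Literature.NumberTheory.PAdicHodge

open Literature.NumberTheory.GaloisRepresentations
open Literature.NumberTheory.GaloisRepresentations.IsNonarchimedeanLocalField

variable {F : Type} [Field F] [ValuativeRel F] [TopologicalSpace F] [IsNonarchimedeanLocalField F]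
  {p : ℕ} [Fact p.Prime] [Fact (¬ IsUnit (p : integerC F))]

/-! ### `φ` and `Γ_F` on `B⁰_max` -/

variable (F p) in
/-- **The Frobenius of `B⁰_max`** (restriction of `φ[1/p]`). [cite: BergerLaurent2002, §1.2] -/
def frobBmaxZero : bmaxZero F p →+* bmaxZero F p :=
  (frobAinfLoc F p).restrict (bmaxZero F p) (bmaxZero F p) fun _ hx => frobAinfLoc_mem_bmaxZero hx

/-- Unfolding of `frobBmaxZero`. [folklore] -/
@[simp] theorem coe_frobBmaxZero (x : bmaxZero F p) :
    ((frobBmaxZero F p x : bmaxZero F p) : Localization.Away (p : Ainf (p := p) F)) = frobAinfLoc F p x := rfl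

/-- `φ(p) = p` on `B⁰_max`. [folklore] -/
theorem frobBmaxZero_natCast (n : ℕ) : frobBmaxZero F p (n : bmaxZero F p) = n := map_natCast _ n

/-- `φ` maps the ideal `(p)` of `B⁰_max` into itself. [folklore] -/
theorem map_frobBmaxZero_span_le :
    (Ideal.span {(p : bmaxZero F p)}).map (frobBmaxZero F p) ≤ Ideal.span {(p : bmaxZero F p)} := by
  rw [Ideal.map_span, Set.image_singleton, frobBmaxZero_natCast]

section Galois

variable [CharZero F] [IsAdicComplete (Ideal.span {(p : integerC F)}) (integerC F)]

/-- **The action of `σ ∈ Γ_F` on `B⁰_max`** (restriction of `𝕎(σ♭)[1/p]`). [cite: BergerLaurent2002, §1.2] -/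
def galBmaxZero (σ : absoluteGaloisGroup F) : bmaxZero F p →+* bmaxZero F p :=
  (galAinfLoc σ).restrict (bmaxZero F p) (bmaxZero F p) fun _ hx => galAinfLoc_mem_bmaxZero σ hx

/-- Unfolding of `galBmaxZero`. [folklore] -/
@[simp] theorem coe_galBmaxZero (σ : absoluteGaloisGroup F) (x : bmaxZero F p) :
    ((galBmaxZero σ x : bmaxZero F p) : Localization.Away (p : Ainf (p := p) F)) = galAinfLoc σ x := rfl

/-- `galBmaxZero 1 = id`. [folklore] -/
theorem galBmaxZero_one (x : bmaxZero F p) : galBmaxZero (1 : absoluteGaloisGroup F) x = x :=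
  Subtype.ext (galAinfLoc_one (x : Localization.Away (p : Ainf (p := p) F)))

/-- `galBmaxZero (σ τ) = galBmaxZero σ ∘ galBmaxZero τ`. [folklore] -/
theorem galBmaxZero_mul (σ τ : absoluteGaloisGroup F) (x : bmaxZero F p) :
    galBmaxZero (σ * τ) x = galBmaxZero σ (galBmaxZero τ x) :=
  Subtype.ext (galAinfLoc_mul σ τ (x : Localization.Away (p : Ainf (p := p) F)))

/-- `σ(p) = p` on `B⁰_max`. [folklore] -/
theorem galBmaxZero_natCast (σ : absoluteGaloisGroup F) (n : ℕ) : galBmaxZero σ (n : bmaxZero F p) = n :=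
  map_natCast _ n

/-- `σ` maps the ideal `(p)` of `B⁰_max` into itself. [folklore] -/
theorem map_galBmaxZero_span_le (σ : absoluteGaloisGroup F) :
    (Ideal.span {(p : bmaxZero F p)}).map (galBmaxZero σ) ≤ Ideal.span {(p : bmaxZero F p)} := by
  rw [Ideal.map_span, Set.image_singleton, galBmaxZero_natCast]

/-- **`φ` and `Γ_F` commute on `B⁰_max`.** [cite: BergerLaurent2002, §1.2] -/
theorem galBmaxZero_frobBmaxZero (σ : absoluteGaloisGroup F) (x : bmaxZero F p) :
    galBmaxZero σ (frobBmaxZero F p x) = frobBmaxZero F p (galBmaxZero σ x) :=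
  Subtype.ext (galAinfLoc_frobAinfLoc σ (x : Localization.Away (p : Ainf (p := p) F)))

end Galois

/-! ### `B_max⁺ = (B⁰_max)^_{(p)}` -/

variable (F p) in
/-- **`B_max⁺(F)`**: the `p`-adic completion of `B⁰_max = 𝔸_inf[ξ/p]` — Colmez's ring
`{Σ a_n (ξ/p)^n : a_n → 0}`, used by Berger to define crystalline representations
(`B_max = B_max⁺[1/t]`). [cite: BergerLaurent2002, §1.2] -/
abbrev BmaxPlus : Type := AdicCompletion (Ideal.span {(p : bmaxZero F p)}) (bmaxZero F p)

variable (F p) in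
/-- **The Frobenius `φ` of `B_max⁺(F)`** (adic-completion functoriality of `φ` on `B⁰_max`, which fixes `p`).
[cite: BergerLaurent2002, §1.2] -/
def frobBmaxPlus : BmaxPlus F p →+* BmaxPlus F p :=
  adicCompletionMap _ _ (frobBmaxZero F p) map_frobBmaxZero_span_le

/-- **`φ` extends the Frobenius of `B⁰_max`.** [folklore] -/
@[simp] theorem frobBmaxPlus_of (x : bmaxZero F p) :
    frobBmaxPlus F p (AdicCompletion.of (Ideal.span {(p : bmaxZero F p)}) (bmaxZero F p) x) =
      AdicCompletion.of (Ideal.span {(p : bmaxZero F p)}) (bmaxZero F p) (frobBmaxZero F p x) :=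
  adicCompletionMap_of _ _ _ _ x

section GaloisPlus

variable [CharZero F] [IsAdicComplete (Ideal.span {(p : integerC F)}) (integerC F)]

/-- **The action of `σ ∈ Γ_F` on `B_max⁺(F)`.** [cite: BergerLaurent2002, §1.2] -/
def galBmaxPlus (σ : absoluteGaloisGroup F) : BmaxPlus F p →+* BmaxPlus F p :=
  adicCompletionMap _ _ (galBmaxZero σ) (map_galBmaxZero_span_le σ)

/-- **`galBmaxPlus σ` extends the action on `B⁰_max`.** [folklore] -/
@[simp] theorem galBmaxPlus_of (σ : absoluteGaloisGroup F) (x : bmaxZero F p) :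
    galBmaxPlus σ (AdicCompletion.of (Ideal.span {(p : bmaxZero F p)}) (bmaxZero F p) x) =
      AdicCompletion.of (Ideal.span {(p : bmaxZero F p)}) (bmaxZero F p) (galBmaxZero σ x) :=
  adicCompletionMap_of _ _ _ _ x

/-- `galBmaxPlus 1 = id`. [folklore] -/
theorem galBmaxPlus_one (x : BmaxPlus F p) : galBmaxPlus (1 : absoluteGaloisGroup F) x = x := by
  have h1 : galBmaxZero (p := p) (F := F) 1 = RingHom.id _ := RingHom.ext galBmaxZero_one
  unfold galBmaxPlus
  rw [adicCompletionMap_congr _ _ h1 _ (by simp), adicCompletionMap_id]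

/-- `galBmaxPlus (σ τ) = galBmaxPlus σ ∘ galBmaxPlus τ`. [folklore] -/
theorem galBmaxPlus_mul (σ τ : absoluteGaloisGroup F) (x : BmaxPlus F p) :
    galBmaxPlus (σ * τ) x = galBmaxPlus σ (galBmaxPlus τ x) := by
  have h : galBmaxZero (p := p) (F := F) (σ * τ) = (galBmaxZero σ).comp (galBmaxZero τ) :=
    RingHom.ext (galBmaxZero_mul σ τ)
  unfold galBmaxPlus
  rw [adicCompletionMap_comp]
  exact adicCompletionMap_congr _ _ h _ _ x

/-- **The `Γ_F`-action on `B_max⁺(F)`** by ring automorphisms. [cite: BergerLaurent2002, §1.2] -/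
instance instMulSemiringActionBmaxPlus : MulSemiringAction (absoluteGaloisGroup F) (BmaxPlus F p) where
  smul σ x := galBmaxPlus σ x
  one_smul x := galBmaxPlus_one x
  mul_smul σ τ x := galBmaxPlus_mul σ τ x
  smul_zero _ := map_zero _
  smul_add _ x y := map_add _ x y
  smul_one _ := map_one _
  smul_mul _ x y := map_mul _ x y

/-- Unfolding of the action. [folklore] -/
theorem smul_bmaxPlus_def (σ : absoluteGaloisGroup F) (x : BmaxPlus F p) : σ • x = galBmaxPlus σ x := rfl

/-- **`φ` commutes with the `Γ_F`-action on `B_max⁺(F)`.** [cite: BergerLaurent2002, §1.2] -/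
theorem galBmaxPlus_frobBmaxPlus (σ : absoluteGaloisGroup F) (x : BmaxPlus F p) :
    galBmaxPlus σ (frobBmaxPlus F p x) = frobBmaxPlus F p (galBmaxPlus σ x) := by
  have h : (galBmaxZero (p := p) (F := F) σ).comp (frobBmaxZero F p) = (frobBmaxZero F p).comp (galBmaxZero σ) :=
    RingHom.ext (galBmaxZero_frobBmaxZero σ)
  unfold galBmaxPlus frobBmaxPlus
  have e1 := adicCompletionMap_comp (Ideal.span {(p : bmaxZero F p)}) (Ideal.span {(p : bmaxZero F p)})
    (Ideal.span {(p : bmaxZero F p)}) (frobBmaxZero F p) (galBmaxZero (p := p) σ) map_frobBmaxZero_span_le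
    (map_galBmaxZero_span_le σ) x
  have e2 := adicCompletionMap_comp (Ideal.span {(p : bmaxZero F p)}) (Ideal.span {(p : bmaxZero F p)})
    (Ideal.span {(p : bmaxZero F p)}) (galBmaxZero (p := p) σ) (frobBmaxZero F p) (map_galBmaxZero_span_le σ)
    map_frobBmaxZero_span_le x
  exact e1.trans ((adicCompletionMap_congr _ _ h _ _ x).trans e2.symm)

end GaloisPlus

/-! ### `𝔸_inf → B_max⁺` -/

variable (F p) in
/-- **`𝔸_inf(F) → B_max⁺(F)`** (through `B⁰_max`). [cite: BergerLaurent2002, §1.2] -/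
def ainfToBmaxPlus : Ainf (p := p) F →+* BmaxPlus F p :=
  (algebraMap (bmaxZero F p) (BmaxPlus F p)).comp (algebraMap (Ainf (p := p) F) (bmaxZero F p))

/-- Unfolding of `ainfToBmaxPlus`. [folklore] -/
theorem ainfToBmaxPlus_apply (x : Ainf (p := p) F) :
    ainfToBmaxPlus F p x =
      AdicCompletion.of (Ideal.span {(p : bmaxZero F p)}) (bmaxZero F p) (algebraMap (Ainf (p := p) F) (bmaxZero F p) x) := rfl

/-- The structure map `𝔸_inf → B⁰_max` in `𝔸_inf[1/p]`. [folklore] -/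
theorem coe_algebraMap_bmaxZero (x : Ainf (p := p) F) :
    ((algebraMap (Ainf (p := p) F) (bmaxZero F p) x : bmaxZero F p) : Localization.Away (p : Ainf (p := p) F)) =
      algebraMap (Ainf (p := p) F) (Localization.Away (p : Ainf (p := p) F)) x := rfl

/-- **`𝔸_inf → B_max⁺` is `φ`-equivariant.** [cite: BergerLaurent2002, §1.2] -/
theorem frobBmaxPlus_ainfToBmaxPlus (x : Ainf (p := p) F) :
    frobBmaxPlus F p (ainfToBmaxPlus F p x) = ainfToBmaxPlus F p (WittVector.frobenius x) := by
  rw [ainfToBmaxPlus_apply, frobBmaxPlus_of, ainfToBmaxPlus_apply]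
  congr 1
  exact Subtype.ext (frobAinfLoc_algebraMap x)

/-- **`𝔸_inf → B_max⁺` is `Γ_F`-equivariant.** [cite: BergerLaurent2002, §1.2] -/
theorem galBmaxPlus_ainfToBmaxPlus [CharZero F] [IsAdicComplete (Ideal.span {(p : integerC F)}) (integerC F)]
    (σ : absoluteGaloisGroup F) (x : Ainf (p := p) F) :
    galBmaxPlus σ (ainfToBmaxPlus F p x) = ainfToBmaxPlus F p (galAinf σ x) := by
  rw [ainfToBmaxPlus_apply, galBmaxPlus_of, ainfToBmaxPlus_apply]
  congr 1
  exact Subtype.ext (galAinfLoc_algebraMap σ x)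


/-! ### Appendix (φ-road of line `kato_lever`, crux K★ `stmt-BirchSwinnertonDyer-22226`): `frobBmaxPlus` as `adicCompletionMap`, level formula -/

section PhiRoadPlus

/-- **`frobBmaxPlus` only depends on `frobBmaxZero`** (proof-irrelevance in the ideal-compatibility argument of `adicCompletionMap`):
any `adicCompletionMap _ _ (frobBmaxZero F p) h` is `frobBmaxPlus F p`. [cite: BergerLaurent2002, §1.2] -/
theorem adicCompletionMap_frobBmaxZero_eq (h : (Ideal.span {(p : bmaxZero F p)}).map (frobBmaxZero F p) ≤ Ideal.span {(p : bmaxZero F p)}) :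
    adicCompletionMap _ _ (frobBmaxZero F p) h = frobBmaxPlus F p := rfl

/-- **`φ(x) mod pⁿ = φ̄(x mod pⁿ)`**: the level-`n` formula for the Frobenius of `B_max⁺`. [cite: BergerLaurent2002, §1.2] -/
theorem evalₐ_frobBmaxPlus (n : ℕ) (x : BmaxPlus F p) :
    AdicCompletion.evalₐ (Ideal.span {(p : bmaxZero F p)}) n (frobBmaxPlus F p x) =
      Ideal.quotientMap (Ideal.span {(p : bmaxZero F p)} ^ n) (frobBmaxZero F p)
        (pow_le_comap_pow_of_map_le (frobBmaxZero F p) map_frobBmaxZero_span_le n)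
        (AdicCompletion.evalₐ (Ideal.span {(p : bmaxZero F p)}) n x) :=
  evalₐ_adicCompletionMap _ _ _ _ n x

end PhiRoadPlus

end Literature.NumberTheory.PAdicHodge

end
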